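import Literature.AnabelianGeometry.AbsoluteAnabelian.AbsTopIII.Thm19PUgtProofs
import HarnessLib

/-!
# [AbsTopIII] Thm. 1.9 (c): `P_U^{gt} = P_U` — additivity of cuspidal degrees and the closer of `Thm19c`
# modulo the cuspidal degree / realization laws (proof-only)

Mochizuki, *Topics in Absolute Anabelian Geometry III*, §1, Theorem 1.9 (c), manuscript p. 37 (lit key
`paper:url-5493eb38cbb7`): "one constructs the subgroup `P_U ⊆ H¹(Π_U, μ_Ẑ(Π_U))` determined by the
cuspidal principal divisors via the isomorphisms of (b) and the characterization of principal divisors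
given in Proposition 1.6, (ii) [cf. also the decomposition groups of (a); Proposition 1.6, (iii)]";
Prop. 1.6 (iii) p. 35: "restricting cohomology classes of `Π_U` to the various `I_x` [...] yields a natural
exact sequence `1 → (k^×)^∧ → H¹(Π_U, M_X) → ⊕_{x ∈ S} Ẑ` [...] the image of `Γ(U, 𝒪_U^×)` [...] is equal to
the inverse image in `H¹(Π_U, M_X)` of the submodule of `⊕ ℤ ⊆ ⊕ Ẑ` determined by the principal divisors".

Proof-only companion of `Thm19CuspidalDegree.lean` (abc-iut-w5-d213, p415100) and sequel of
`Thm19PUgtProofs.lean` (p416334; Galois half `galoisClasses_subset_PUgt`); sub-DAG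
`plan/L4/SUBDAG-AbsTopIII-Thm19.md`, row Thm19.c.r6 (cell abc-iut; holder abc-iut-w5-d213 g2 per
abc-iut-L4-lead RULING #3y (4)).  Contents:

* additivity of the class of a continuous crossed homomorphism (`crossedHomClass_add`, `crossedHomClass_neg`
  — generic, over the tree's `ContinuousCohomology.crossedHomClass`);
* cuspidal degrees are additive: `HasCuspidalDegree.add/neg/sub` (degrees read through THE synchronization
  of (b)); the cuspidal divisor is additive; hence the group-theoretic `P_U^{gt}` (`PUgt`) is closed under
  `0`, `+`, `−` (`zero_mem_PUgt`, `add_mem_PUgt`, `neg_mem_PUgt`, `sub_mem_PUgt`);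
* the two halves of `PUgt = PU`: `PU_subset_PUgt_of_kummer` (⟸ the Galois half + "`κ_U(f) ∈ P_U^{gt}`" for
  every regular unit) and `PUgt_subset_PU_of_realize` (⟸ `Prop_1_6_iii_ker` + "every principal cuspidal
  divisor is realised by a regular unit with those cuspidal degrees");
* the closer `thm19c_of_cuspidalLaws : … → M.Thm19c` from abc-iut-L4-t1's named fact `Prop_1_6_iii_ker` BY
  NAME and ONE explicit hypothesis: the two CUSPIDAL LAWS per presentation — (L1) DEGREE LAW "`D ∘ κ_U = div`":
  the Kummer class of a regular unit `f` of `U` has INTEGRAL cuspidal degrees forming a principal divisor of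
  `Z` (at the intended model: `ord_{z}(f)` at the filled-in points, principal witnessed by `f` itself —
  needs the identifications `K_U = K_Z` (I1) and `Point U ↪ Point Z` (I2) of cell GAP-LEDGER D-G-w5d213-1,
  which `CurveModel`/`DivisorCurveModel` do not carry) and (L2) REALIZATION: a principal cuspidal divisor is
  the divisor of a regular unit of `U` whose Kummer class has those degrees (same identifications + the
  degree clause of Prop. 1.6 (iii)).  Exact Lean shapes = the binders below; the abc-iut-L4-t1 lineage's
  per-curve successor structure is to DERIVE (L1)(L2).

No definition, no new named fact.  HONEST FRAMING: typed ≠ proved for (L1)(L2); nothing here bears on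
[IUTchIII] Cor. 3.12.
-/

noncomputable section

open CategoryTheory
open scoped Classical Pointwise

namespace Literature.AnabelianGeometry.AbsoluteAnabelian.AbsTopIII

universe u

/-! ### Additivity of the class of a crossed homomorphism -/

section CrossedHom

variable {G : Type u} [Group G] [TopologicalSpace G] [IsTopologicalGroup G] (X : TopRep.{u} ℤ G)

omit [IsTopologicalGroup G] in
/-- The sum of two continuous crossed homomorphisms is a crossed homomorphism.
[cite: SerreGaloisCohomology1997, I §2.3] -/
theorem crossedHom_add {f g : C(G, X)} (hf : ∀ x y, f (x * y) = f x + X.ρ x (f y))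
    (hg : ∀ x y, g (x * y) = g x + X.ρ x (g y)) (x y : G) :
    (f + g) (x * y) = (f + g) x + X.ρ x ((f + g) y) := by
  simp only [ContinuousMap.add_apply, hf, hg, map_add]
  abel

omit [IsTopologicalGroup G] in
/-- The negative of a continuous crossed homomorphism is a crossed homomorphism.
[cite: SerreGaloisCohomology1997, I §2.3] -/
theorem crossedHom_neg {f : C(G, X)} (hf : ∀ x y, f (x * y) = f x + X.ρ x (f y)) (x y : G) :
    (-f) (x * y) = (-f) x + X.ρ x ((-f) y) := by
  simp only [ContinuousMap.neg_apply, hf, map_neg]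
  abel

/-- **The class of a crossed homomorphism is ADDITIVE in the crossed homomorphism**:
`[f + g] = [f] + [g]` in `H¹(G, X)`. [cite: SerreGaloisCohomology1997, I §2.3] -/
theorem crossedHomClass_add (f g : C(G, X)) (hf : ∀ x y, f (x * y) = f x + X.ρ x (f y))
    (hg : ∀ x y, g (x * y) = g x + X.ρ x (g y))
    (hfg : ∀ x y, (f + g) (x * y) = (f + g) x + X.ρ x ((f + g) y)) :
    ContinuousCohomology.crossedHomClass X (f + g) hfg =
      ContinuousCohomology.crossedHomClass X f hf + ContinuousCohomology.crossedHomClass X g hg := by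
  have hcyc : ContinuousCohomology.crossedHomCocycle X (f + g) hfg =
      ContinuousCohomology.crossedHomCocycle X f hf + ContinuousCohomology.crossedHomCocycle X g hg := by
    apply ContinuousCohomology.cocycles_ext
    rw [map_add]
    apply Subtype.ext
    have hval : ∀ a b : X.homogeneousCochains.X 1, (a + b).1 = a.1 + b.1 := fun _ _ => rfl
    rw [hval, ContinuousCohomology.iCycles_crossedHomCocycle,
      ContinuousCohomology.iCycles_crossedHomCocycle, ContinuousCohomology.iCycles_crossedHomCocycle]
    exact map_add (ContinuousCohomology.twoOf X) f g
  unfold ContinuousCohomology.crossedHomClass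
  rw [hcyc, map_add]

/-- `[-f] = -[f]` in `H¹(G, X)`. [cite: SerreGaloisCohomology1997, I §2.3] -/
theorem crossedHomClass_neg (f : C(G, X)) (hf : ∀ x y, f (x * y) = f x + X.ρ x (f y))
    (hnf : ∀ x y, (-f) (x * y) = (-f) x + X.ρ x ((-f) y)) :
    ContinuousCohomology.crossedHomClass X (-f) hnf = -ContinuousCohomology.crossedHomClass X f hf := by
  have h0 : ContinuousCohomology.crossedHomClass X (f + -f) (crossedHom_add X hf hnf) = 0 :=
    crossedHomClass_zero X _ (fun x => by simp) _
  rw [crossedHomClass_add X f (-f) hf hnf] at h0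
  exact eq_neg_of_add_eq_zero_right h0

end CrossedHom

/-! ### Cuspidal degrees are additive; `P_U^{gt}` is closed under the group operations -/

namespace CurveModel

variable {M : CurveModel.{u}} {U Z : M.Curve} {h : M.IsCofiniteOpen U Z} (P : M.CuspSyncPresentation h)

/-- **Cuspidal degrees add**: if `η` has degree `n` and `η'` degree `m` at `z` (through THE synchronization of
(b)), then `η + η'` has degree `n + m`. [cite: MochizukiAbsTopIII2015, Prop 1.6 (iii) p.35] -/
theorem HasCuspidalDegree.add {η η' : cyclotomeModH1 (M.res h) ZHatCoeff.{u}} {z : (M.cusps U).Cusp}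
    {n m : ℤ} (hη : HasCuspidalDegree P η z n) (hη' : HasCuspidalDegree P η' z m) :
    HasCuspidalDegree P (η + η') z (n + m) := by
  obtain ⟨hc, hf, heq⟩ := hη
  obtain ⟨hc', hf', heq'⟩ := hη'
  have hsum : (⟨_, hc⟩ : C((M.cusps U).Icusp z, M.inertiaRep h z)) + ⟨_, hc'⟩ =
      ⟨fun i : (M.cusps U).Icusp z => (n + m) • P.syncAt z (Additive.ofMul i),
        by simpa only [add_smul, Pi.add_def] using hc.add hc'⟩ := by
    ext i
    simp [add_smul]
  refine ⟨by simpa only [add_smul, Pi.add_def] using hc.add hc', ?_, ?_⟩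
  · intro x y
    have h2 := crossedHom_add (M.inertiaRep h z) hf hf' x y
    rw [hsum] at h2
    exact h2
  · have hadd : (cyclotomeModH1Res (M.res h) ZHatCoeff.{u} ((M.cusps U).Icusp z)) (η + η') =
        (cyclotomeModH1Res (M.res h) ZHatCoeff.{u} ((M.cusps U).Icusp z)) η +
          (cyclotomeModH1Res (M.res h) ZHatCoeff.{u} ((M.cusps U).Icusp z)) η' :=
      map_add (cyclotomeModH1Res (M.res h) ZHatCoeff.{u} ((M.cusps U).Icusp z)).hom η η'
    rw [hadd, heq, heq', ← crossedHomClass_add (M.inertiaRep h z) _ _ hf hf'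
      (crossedHom_add (M.inertiaRep h z) hf hf')]
    exact crossedHomClass_congr _ hsum _ _

/-- **Cuspidal degrees negate**: if `η` has degree `n` at `z` then `-η` has degree `-n`.
[cite: MochizukiAbsTopIII2015, Prop 1.6 (iii) p.35] -/
theorem HasCuspidalDegree.neg {η : cyclotomeModH1 (M.res h) ZHatCoeff.{u}} {z : (M.cusps U).Cusp}
    {n : ℤ} (hη : HasCuspidalDegree P η z n) : HasCuspidalDegree P (-η) z (-n) := by
  obtain ⟨hc, hf, heq⟩ := hη
  have hneg : -(⟨_, hc⟩ : C((M.cusps U).Icusp z, M.inertiaRep h z)) =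
      ⟨fun i : (M.cusps U).Icusp z => (-n) • P.syncAt z (Additive.ofMul i),
        by simpa only [neg_smul, Pi.neg_def] using hc.neg⟩ := by
    ext i
    simp [neg_smul]
  refine ⟨by simpa only [neg_smul, Pi.neg_def] using hc.neg, ?_, ?_⟩
  · intro x y
    have h2 := crossedHom_neg (M.inertiaRep h z) hf x y
    rw [hneg] at h2
    exact h2
  · have hn : (cyclotomeModH1Res (M.res h) ZHatCoeff.{u} ((M.cusps U).Icusp z)) (-η) =
        -(cyclotomeModH1Res (M.res h) ZHatCoeff.{u} ((M.cusps U).Icusp z)) η :=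
      map_neg (cyclotomeModH1Res (M.res h) ZHatCoeff.{u} ((M.cusps U).Icusp z)).hom η
    rw [hn, heq, ← crossedHomClass_neg (M.inertiaRep h z) _ hf (crossedHom_neg (M.inertiaRep h z) hf)]
    exact crossedHomClass_congr _ hneg _ _

/-- Cuspidal degrees subtract. [cite: MochizukiAbsTopIII2015, Prop 1.6 (iii) p.35] -/
theorem HasCuspidalDegree.sub {η η' : cyclotomeModH1 (M.res h) ZHatCoeff.{u}} {z : (M.cusps U).Cusp}
    {n m : ℤ} (hη : HasCuspidalDegree P η z n) (hη' : HasCuspidalDegree P η' z m) :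
    HasCuspidalDegree P (η - η') z (n - m) := by
  rw [sub_eq_add_neg, sub_eq_add_neg]
  exact HasCuspidalDegree.add P hη (HasCuspidalDegree.neg P hη')

namespace CuspSyncPresentation

/-- The cuspidal divisor is additive in the multiplicities. [cite: MochizukiAbsTopIII2015, Thm 1.9 (c) p.37] -/
theorem cuspidalDivisor_add (D D' : (M.cusps U).Cusp → ℤ) :
    P.cuspidalDivisor (D + D') = P.cuspidalDivisor D + P.cuspidalDivisor D' := by
  simp [cuspidalDivisor, Finset.sum_add_distrib]

/-- The cuspidal divisor of the negated multiplicities. [cite: MochizukiAbsTopIII2015, Thm 1.9 (c) p.37] -/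
theorem cuspidalDivisor_neg (D : (M.cusps U).Cusp → ℤ) :
    P.cuspidalDivisor (-D) = -P.cuspidalDivisor D := by
  simp [cuspidalDivisor, Finset.sum_neg_distrib]

end CuspSyncPresentation

end CurveModel

namespace DivisorCurveModel

variable (M : DivisorCurveModel.{u}) {X : M.Curve}

/-- `div(f g) = div f + div g`: principal divisors are closed under addition.
[cite: MochizukiAbsTopIII2015, Prop 1.6 (ii) p.35] -/
theorem IsPrincipal.add {D D' : M.Point X →₀ ℤ} (hD : M.IsPrincipal D) (hD' : M.IsPrincipal D') :
    M.IsPrincipal (D + D') := by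
  obtain ⟨f, hf⟩ := hD
  obtain ⟨g, hg⟩ := hD'
  exact ⟨f * g, fun x => by rw [map_mul, toAdd_mul, hf x, hg x, Finsupp.add_apply]⟩

/-- `div(f⁻¹) = -div f`: principal divisors are closed under negation.
[cite: MochizukiAbsTopIII2015, Prop 1.6 (ii) p.35] -/
theorem IsPrincipal.neg {D : M.Point X →₀ ℤ} (hD : M.IsPrincipal D) : M.IsPrincipal (-D) := by
  obtain ⟨f, hf⟩ := hD
  exact ⟨f⁻¹, fun x => by rw [map_inv, toAdd_inv, hf x, Finsupp.neg_apply]⟩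

end DivisorCurveModel

namespace IntrinsicKummerModel

variable (M : IntrinsicKummerModel.{u}) {U Z : M.Curve} {h : M.IsCofiniteOpen U Z}
  (P : M.toCurveModel.CuspSyncPresentation h)

/-- `0 ∈ P_U^{gt}` (all degrees `0`, the zero divisor). [cite: MochizukiAbsTopIII2015, Thm 1.9 (c) p.37] -/
theorem zero_mem_PUgt : (0 : cyclotomeModH1 (M.res h) ZHatCoeff.{u}) ∈ M.PUgt P := by
  refine ⟨fun _ => 0, fun z => (CurveModel.hasCuspidalDegree_zero_iff P 0 z).2 (map_zero _), ?_⟩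
  rw [CurveModel.CuspSyncPresentation.cuspidalDivisor_zero]
  exact M.toDivisorCurveModel.isPrincipal_zero Z

/-- `P_U^{gt}` is closed under addition. [cite: MochizukiAbsTopIII2015, Thm 1.9 (c) p.37] -/
theorem add_mem_PUgt {η η' : cyclotomeModH1 (M.res h) ZHatCoeff.{u}} (hη : η ∈ M.PUgt P)
    (hη' : η' ∈ M.PUgt P) : η + η' ∈ M.PUgt P := by
  obtain ⟨D, hD, hDp⟩ := hη
  obtain ⟨D', hD', hD'p⟩ := hη'
  refine ⟨D + D', fun z => (hD z).add P (hD' z), ?_⟩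
  rw [CurveModel.CuspSyncPresentation.cuspidalDivisor_add]
  exact DivisorCurveModel.IsPrincipal.add _ hDp hD'p

/-- `P_U^{gt}` is closed under negation. [cite: MochizukiAbsTopIII2015, Thm 1.9 (c) p.37] -/
theorem neg_mem_PUgt {η : cyclotomeModH1 (M.res h) ZHatCoeff.{u}} (hη : η ∈ M.PUgt P) :
    -η ∈ M.PUgt P := by
  obtain ⟨D, hD, hDp⟩ := hη
  refine ⟨-D, fun z => (hD z).neg P, ?_⟩
  rw [CurveModel.CuspSyncPresentation.cuspidalDivisor_neg]
  exact DivisorCurveModel.IsPrincipal.neg _ hDp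

/-- `P_U^{gt}` is closed under subtraction. [cite: MochizukiAbsTopIII2015, Thm 1.9 (c) p.37] -/
theorem sub_mem_PUgt {η η' : cyclotomeModH1 (M.res h) ZHatCoeff.{u}} (hη : η ∈ M.PUgt P)
    (hη' : η' ∈ M.PUgt P) : η - η' ∈ M.PUgt P := by
  rw [sub_eq_add_neg]
  exact M.add_mem_PUgt P hη (M.neg_mem_PUgt P hη')

/-! ### The two halves of `P_U^{gt} = P_U` -/

/-- **`P_U ⊆ P_U^{gt}`** from the Galois half (`Prop_1_6_iii_ker` BY NAME, p416334) and the unit half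
"`κ_U(f) ∈ P_U^{gt}` for every regular unit `f`" (the DEGREE LAW (L1), explicit binder `hK`).
[cite: MochizukiAbsTopIII2015, Thm 1.9 (c) p.37] -/
theorem PU_subset_PUgt_of_kummer (hker : M.Prop_1_6_iii_ker) (hZ : M.IsProper Z) (hU : M.IsScheme U)
    (hZs : M.IsScheme Z) (hg : 2 ≤ M.genus Z) (hk : IsKummerFaithful (M.base U))
    (hrat : ∀ c : (M.cusps U).Cusp, (M.cusps U).IsRational c)
    (hK : ∀ f : M.regularUnits U, Multiplicative.toAdd (M.kummerMap h hZ f) ∈ M.PUgt P) :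
    (M.PU h hZ : Set (cyclotomeModH1 (M.res h) ZHatCoeff.{u})) ⊆ M.PUgt P := by
  intro η hη
  obtain ⟨a, ha, b, hb, rfl⟩ := AddSubgroup.mem_sup.1 hη
  obtain ⟨f, rfl⟩ := ha
  exact M.add_mem_PUgt P (hK (Additive.toMul f))
    (M.galoisClasses_subset_PUgt hker hZ hU hZs hg hk hrat P hb)

/-- **`P_U^{gt} ⊆ P_U`** from `Prop_1_6_iii_ker` BY NAME and the REALIZATION LAW (L2) (explicit binder
`hreal`): a class with integral degrees `D` forming a principal divisor differs from the Kummer class of a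
regular unit realising `D` by a class of degree `0` everywhere, i.e. (through THE synchronization) by a class
with vanishing restrictions to all `I_z`, which is a Galois class. [cite: MochizukiAbsTopIII2015, Thm 1.9 (c) p.37] -/
theorem PUgt_subset_PU_of_realize (hker : M.Prop_1_6_iii_ker) (hZ : M.IsProper Z) (hU : M.IsScheme U)
    (hZs : M.IsScheme Z) (hg : 2 ≤ M.genus Z) (hk : IsKummerFaithful (M.base U))
    (hrat : ∀ c : (M.cusps U).Cusp, (M.cusps U).IsRational c)
    (hreal : ∀ D : (M.cusps U).Cusp → ℤ, M.IsPrincipal (P.cuspidalDivisor D) →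
      ∃ f : M.regularUnits U,
        ∀ z, CurveModel.HasCuspidalDegree P (Multiplicative.toAdd (M.kummerMap h hZ f)) z (D z)) :
    M.PUgt P ⊆ (M.PU h hZ : Set (cyclotomeModH1 (M.res h) ZHatCoeff.{u})) := by
  rintro η ⟨D, hD, hDp⟩
  obtain ⟨f, hf⟩ := hreal D hDp
  have hgal : η - Multiplicative.toAdd (M.kummerMap h hZ f) ∈ M.galoisClasses h := by
    refine (hker U Z h hZ hU hZs hg hk hrat _).1 fun z => ?_
    have h0 := (hD z).sub P (hf z)
    rw [sub_self] at h0
    exact (CurveModel.hasCuspidalDegree_zero_iff P _ z).1 h0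
  have hsum : η = Multiplicative.toAdd (M.kummerMap h hZ f) +
      (η - Multiplicative.toAdd (M.kummerMap h hZ f)) := by abel
  rw [hsum]
  exact AddSubgroup.add_mem _ (M.kummerImage_le_PU h hZ (M.kummer_mem_kummerImage h hZ f))
    (M.galoisClasses_le_PU h hZ hgal)

/-- **Thm. 1.9 (c) modulo the cuspidal laws**: the NAMED statement `Thm19c` (`P_U^{gt} = P_U` for every
presentation) from abc-iut-L4-t1's `Prop_1_6_iii_ker` BY NAME and ONE explicit hypothesis carrying, per
cofinite open `U ⊆ Z` as in (b) and presentation `P`, the DEGREE LAW (L1) "`κ_U(f)` has integral cuspidal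
degrees forming a principal divisor of `Z`" and the REALIZATION LAW (L2) "a principal cuspidal divisor is
realised by a regular unit with those degrees" — Prop. 1.6 (iii)'s clause "the image of `Γ(U, 𝒪_U^×)` [...] is
equal to the inverse image [...] of the submodule of `⊕ ℤ` determined by the principal divisors" read through
the (b)-synchronizations, which needs the identifications `K_U = K_Z` / `Point U ↪ Point Z` absent from the
interface (cell GAP-LEDGER D-G-w5d213-1 (I1)(I2); to be DERIVED from the abc-iut-L4-t1 lineage's per-curve
successor structure). [cite: MochizukiAbsTopIII2015, Thm 1.9 (c) p.37] -/
theorem thm19c_of_cuspidalLaws (hker : M.Prop_1_6_iii_ker)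
    (hlaws : ∀ (U Z : M.Curve) (h : M.IsCofiniteOpen U Z) (hZ : M.IsProper Z), M.IsScheme U →
      M.IsScheme Z → 2 ≤ M.genus Z → IsKummerFaithful (M.base U) →
      (∀ c : (M.cusps U).Cusp, (M.cusps U).IsRational c) →
      ∀ P : M.toCurveModel.CuspSyncPresentation h,
        (∀ f : M.regularUnits U, Multiplicative.toAdd (M.kummerMap h hZ f) ∈ M.PUgt P) ∧
        ∀ D : (M.cusps U).Cusp → ℤ, M.IsPrincipal (P.cuspidalDivisor D) →
          ∃ f : M.regularUnits U,
            ∀ z, CurveModel.HasCuspidalDegree P (Multiplicative.toAdd (M.kummerMap h hZ f)) z (D z)) :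
    M.Thm19c := by
  intro U Z h hZ hU hZs hg hk hrat P
  obtain ⟨hK, hreal⟩ := hlaws U Z h hZ hU hZs hg hk hrat P
  exact Set.Subset.antisymm (M.PUgt_subset_PU_of_realize P hker hZ hU hZs hg hk hrat hreal)
    (M.PU_subset_PUgt_of_kummer P hker hZ hU hZs hg hk hrat hK)

end IntrinsicKummerModel

end Literature.AnabelianGeometry.AbsoluteAnabelian.AbsTopIII
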